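import Mathlib
import Summits.NavierStokesRegularity.NavierStokesRegularity.Theorems.SubOnsagerCeilingKPChainKolmogorovForm
import HarnessLib

/-!
# Entropy production of the Kolmogorov entropies `S_p` along the viscous Katz–Pavlović chain
# (helper file for the crux `SubOnsagerCeiling.ForwardTailCeilingKP`, stmt-NavierStokesRegularity-27057, `--supports`;
# hand leafhand-ns-subonsagerceiling-4 gen 24; def-free)

Chain format VERBATIM that of `Theorems/SubOnsagerCeilingKPChainKolmogorovForm.lean` / `…KPChainPeak.lean` and of the
LEAD's chain rungs: `Ż_k = c₀ (b^{5(k-1)/2} Z_{k-1}² − b^{5k/2} Z_k Z_{k+1}) − ν b^{2k} Z_k` within `[0,s]`, `Z_{-1} ≡ 0`.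
Shell energies `E_n = ½ Z_n²`, bond fluxes `Π_n = c₀ b^{5n/2} Z_n² Z_{n+1}` (`= Z_n ·` drain of shell `n` `=` feed of
shell `n+1` `· Z_{n+1}`).

Hands 4-g6 / 4-g10 proposed to attack the registered stubs `stub_primaryGradedLargeRatio` / `stub_primaryGradedSmallRatio`
(restricted to the one-mode chain: a ν-uniform `θ`-shell barrier, `θ > 1/2`, at every ratio `b ∈ (1,2]`) in the SUM
currency of the Kolmogorov entropies `S_p(t) = Σ_n β^n E_n(t)^p`, `β = b^{(5/3)(p-1)}` (exchange rate with the barrier: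
`Theorems/SubOnsagerCeilingKPEntropyCurrency.lean`, p832670; transfer to the registered currency for every table:
`Theorems/SubOnsagerCeilingKPEntropyCeilingTransfer.lean`): an `S_p`-ceiling with `p > 5/2` IS a `θ_p = (5/6)(1−1/p) > 1/2`
barrier, and numerically `sup_t S_p(t) = S_p(0)` along the chain from a one-shell datum for `p ≤ 4` at every tested
`b ∈ [1.05, 2]` (memos ENTROPY-CENSUS-leafhand4-g6 / ENTROPY-NETWORKS-leafhand4-g10 on the item).  Those files are
STATIC (one time slice).  This file lands the DYNAMIC half — the exact entropy production along the flow: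

* `sum_weight_mul_fluxDiff_telescope` — the summation by parts behind every weighted energy law of the chain;
* **`entropyPartialSum_hasDerivWithinAt`** — for arbitrary shell weights `c : ℕ → ℝ`, every power `p ≥ 1` and every
  depth `N`, within `[0,s]`:
  `d/dt Σ_{n≤N} c_n E_n^p = p Σ_{n<N} Π_n (c_{n+1} E_{n+1}^{p-1} − c_n E_n^{p-1}) − p c_N E_N^{p-1} Π_N − p Σ_{n≤N} 2ν b^{2n} c_n E_n^p`
  (production at the interior bonds + outflow through the top bond + dissipation; `p = 1`, `c ≡ 1` is the low-energy
  balance, `c_n = b^{2θn}`, `p = 1` the weighted-energy law `Σ_{n<N} (b^{2θ} − 1) b^{2θn} Π_n − …`);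
* `entropyWeight_production_kolmogorovForm` — for the ENTROPY weights `c_n = β^n`, `β = (b^{5/3})^{p-1}`, the production
  density is SHELL-FREE in the Kolmogorov currency `w_n := (b^{5/3})^n E_n` (`= ½u_n²`, `u_n = (b^{5/6})^n Z_n`):
  `β^{n+1} E_{n+1}^{p-1} − β^n E_n^{p-1} = w_{n+1}^{p-1} − w_n^{p-1}`, so that
  `Ṡ_p^{(N)} = −p Σ_{n<N} Π_n (w_n^{p-1} − w_{n+1}^{p-1}) − p w_N^{p-1} Π_N − (dissipation)`:
  **entropy is produced only at INVERTED lit bonds** (`w_{n+1} > w_n`: Kolmogorov-weighted energy increasing across a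
  bond that carries flux) and destroyed at steep ones — the lattice form of Kružkov's inequality for the continuum limit
  `W_T + (W^{3/2})_ξ = 0` [cite: Kruzkov1970, §3 Thm. 1], whose production vanishes identically on the K41 plateaus
  `w ≡ const` (`Theorems.KPChainFront.kolmogorov_constants_are_equilibria`);
* `entropyPartialSum_antitoneOn` — sign corollary (non-negative chain, `c₀, ν ≥ 0`, weights `≥ 0`): on a window where
  `c_{n+1} E_{n+1}^{p-1} ≤ c_n E_n^{p-1}` at every bond `n < N` and every time, the partial entropy `Σ_{n≤N} c_n E_n^p`
  is non-increasing (for the entropy weights: «no inverted bond below `N`» ⇒ `S_p^{(N)}` decays);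
* `entropyPartialSum_datum` — from the one-shell datum `Z_k(0) = x₀ 1_{k=0}`: `Σ_{n≤N} c_n E_n(0)^p = c_0 (½x₀²)^p`.

Reading (repair census, small-ratio item (A′1) / entropy route of 4-g6): a violation of the `θ_p`-barrier with constant
`1` at some shell `n ≤ N` and time `t` forces `S_p^{(N)}(t) > S_p^{(N)}(0)`, i.e. a net POSITIVE time-integral of the
inverted-bond production `p Σ_{n<N} Π_n (w_{n+1}^{p-1} − w_n^{p-1})₊` exceeding the steep-bond destruction, the top
outflow and the dissipation on `[0,t]` — the sum-currency form of «the barrier can only fail by a pile-up behind the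
front», to be compared with the sup-currency dichotomy `Theorems.KPChainFront.barrier_or_firstOvershoot`.  What is NOT
proved here: any bound on the inverted-bond production along the actual trajectory (that is the open dynamics of the stubs).
HONEST FRAMING: elementary identities about a MODEL lattice ODE (route SubOnsagerCeiling, rung TL-M2Break); no stub, crux or
summit is proved here and nothing in this file bears on Navier–Stokes regularity.
[cite: Tao2016AveragedNS, §4 (4.13)] [cite: BarbatoMorandinRomito2011, §2 (the chain)]
-/

noncomputable section

-- the sub-problem namespace `NavierStokesRegularity.NavierStokesRegularity` is the tree's layout (D-0017)
set_option linter.dupNamespace false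

namespace Summit.NavierStokesRegularity.NavierStokesRegularity.Theorems.KPChainEntropy

open Set Finset

/-! ## Summation by parts -/

/-- **Summation by parts for a flux chain.**  For weights `a_n` and bond values `P_n` (with the convention `P_{-1} = 0`):
`Σ_{n≤N} a_n (P_{n-1} − P_n) = Σ_{n<N} P_n (a_{n+1} − a_n) − a_N P_N`. [folklore] -/
theorem sum_weight_mul_fluxDiff_telescope (a P : ℕ → ℝ) (N : ℕ) :
    ∑ n ∈ range (N + 1), a n * ((if n = 0 then 0 else P (n - 1)) - P n) =
      ∑ n ∈ range N, P n * (a (n + 1) - a n) - a N * P N := by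
  induction N with
  | zero => simp
  | succ N ih =>
      rw [Finset.sum_range_succ, ih, Finset.sum_range_succ]
      have h : (if N + 1 = 0 then (0 : ℝ) else P (N + 1 - 1)) = P N := by simp
      rw [h]
      ring

/-! ## The entropy production identity -/

/-- **Entropy production along the viscous chain (arbitrary weights).**  If `Z` solves the viscous Katz–Pavlović
chain within `[0,s]` (LEAD format, `Z_{-1} ≡ 0`), then for all weights `c : ℕ → ℝ`, every power `p ≥ 1` and every
depth `N`, the partial sum `Σ_{n≤N} c_n E_n^p`, `E_n = ½Z_n²`, has within `[0,s]` the derivative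
`p Σ_{n<N} Π_n (c_{n+1} E_{n+1}^{p-1} − c_n E_n^{p-1}) − p c_N E_N^{p-1} Π_N − p Σ_{n≤N} 2ν b^{2n} c_n E_n^p`,
`Π_n = c₀ b^{5n/2} Z_n² Z_{n+1}` (any signs, any `ν`, any `b`). [this file] -/
theorem entropyPartialSum_hasDerivWithinAt {b c₀ ν s : ℝ} {Z : ℤ → ℝ → ℝ}
    (hvan : ∀ t, Z (-1) t = 0)
    (hode : ∀ k : ℕ, ∀ t ∈ Icc 0 s, HasDerivWithinAt (Z k)
      (c₀ * (b ^ ((5 : ℝ) * ((k : ℝ) - 1) / 2) * Z ((k : ℤ) - 1) t ^ 2 -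
          b ^ ((5 : ℝ) * (k : ℝ) / 2) * (Z k t * Z ((k : ℤ) + 1) t)) -
        ν * b ^ ((2 : ℝ) * (k : ℝ)) * Z k t) (Icc 0 s) t)
    (c : ℕ → ℝ) {p : ℕ} (hp : 1 ≤ p) (N : ℕ) {t : ℝ} (ht : t ∈ Icc 0 s) :
    HasDerivWithinAt (fun τ => ∑ n ∈ range (N + 1), c n * ((1 / 2 : ℝ) * Z n τ ^ 2) ^ p)
      ((p : ℝ) * ∑ n ∈ range N,
          (c₀ * b ^ ((5 : ℝ) * (n : ℝ) / 2) * Z n t ^ 2 * Z ((n : ℤ) + 1) t) *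
            (c (n + 1) * ((1 / 2 : ℝ) * Z ((n : ℤ) + 1) t ^ 2) ^ (p - 1) -
              c n * ((1 / 2 : ℝ) * Z n t ^ 2) ^ (p - 1)) -
        (p : ℝ) * (c N * ((1 / 2 : ℝ) * Z N t ^ 2) ^ (p - 1)) *
          (c₀ * b ^ ((5 : ℝ) * (N : ℝ) / 2) * Z N t ^ 2 * Z ((N : ℤ) + 1) t) -
        (p : ℝ) * ∑ n ∈ range (N + 1),
          2 * (ν * b ^ ((2 : ℝ) * (n : ℝ))) * (c n * ((1 / 2 : ℝ) * Z n t ^ 2) ^ p))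
      (Icc 0 s) t := by
  obtain ⟨q, rfl⟩ : ∃ q, p = q + 1 := ⟨p - 1, by omega⟩
  simp only [Nat.add_sub_cancel]
  -- abbreviations (values at the time `t`)
  set E : ℤ → ℝ := fun k => (1 / 2 : ℝ) * Z k t ^ 2 with hE
  set flux : ℕ → ℝ := fun n => c₀ * b ^ ((5 : ℝ) * (n : ℝ) / 2) * Z n t ^ 2 * Z ((n : ℤ) + 1) t with hflux
  set feed : ℕ → ℝ := fun n =>
    c₀ * b ^ ((5 : ℝ) * ((n : ℝ) - 1) / 2) * Z ((n : ℤ) - 1) t ^ 2 * Z n t with hfeed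
  set a : ℕ → ℝ := fun n => ((q + 1 : ℕ) : ℝ) * (c n * E n ^ q) with ha
  -- the feed of shell `n` is the flux of the bond below (and vanishes for the datum shell)
  have hfeed_eq : ∀ n : ℕ, feed n = if n = 0 then 0 else flux (n - 1) := by
    intro n
    rcases Nat.eq_zero_or_pos n with rfl | hn
    · have hv : Z (-1) t = 0 := hvan t
      simp [hfeed, hv]
    · obtain ⟨m, rfl⟩ : ∃ m, n = m + 1 := ⟨n - 1, by omega⟩
      have h1 : (((m + 1 : ℕ) : ℝ) - 1) = (m : ℝ) := by push_cast; ring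
      have h3 : (((m + 1 : ℕ) : ℤ)) = (m : ℤ) + 1 := by push_cast; ring
      have hne : m + 1 ≠ 0 := by omega
      rw [if_neg hne]
      simp only [hfeed, hflux, Nat.add_sub_cancel, h1, h3, add_sub_cancel_right]
  -- derivative of one term
  have hterm : ∀ n ∈ range (N + 1), HasDerivWithinAt (fun τ => c n * ((1 / 2 : ℝ) * Z n τ ^ 2) ^ (q + 1))
      (a n * (feed n - flux n) - ((q + 1 : ℕ) : ℝ) * (2 * (ν * b ^ ((2 : ℝ) * (n : ℝ))) * (c n * E n ^ (q + 1))))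
      (Icc 0 s) t := by
    intro n _
    have h1 := ((hode n t ht).pow 2).const_mul (1 / 2 : ℝ)
    have h2 := (h1.pow (q + 1)).const_mul (c n)
    refine h2.congr_deriv ?_
    simp only [ha, hfeed, hflux, hE, Pi.pow_apply, Nat.add_sub_cancel]
    push_cast
    ring
  have hsum := HasDerivWithinAt.fun_sum (u := range (N + 1))
    (A := fun n τ => c n * ((1 / 2 : ℝ) * Z n τ ^ 2) ^ (q + 1))
    (A' := fun n => a n * (feed n - flux n) -
      ((q + 1 : ℕ) : ℝ) * (2 * (ν * b ^ ((2 : ℝ) * (n : ℝ))) * (c n * E n ^ (q + 1))))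
    (x := t) (s := Icc 0 s) hterm
  refine hsum.congr_deriv ?_
  rw [Finset.sum_sub_distrib]
  have htel : ∑ n ∈ range (N + 1), a n * (feed n - flux n) =
      ∑ n ∈ range N, flux n * (a (n + 1) - a n) - a N * flux N := by
    rw [Finset.sum_congr rfl fun n _ => by rw [hfeed_eq n]]
    exact sum_weight_mul_fluxDiff_telescope a flux N
  rw [htel]
  have hA : ∑ n ∈ range N, flux n * (a (n + 1) - a n) =
      ((q + 1 : ℕ) : ℝ) * ∑ n ∈ range N,
        (c₀ * b ^ ((5 : ℝ) * (n : ℝ) / 2) * Z n t ^ 2 * Z ((n : ℤ) + 1) t) *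
          (c (n + 1) * ((1 / 2 : ℝ) * Z ((n : ℤ) + 1) t ^ 2) ^ q - c n * ((1 / 2 : ℝ) * Z n t ^ 2) ^ q) := by
    rw [Finset.mul_sum]
    refine Finset.sum_congr rfl fun n _ => ?_
    have h3 : (((n + 1 : ℕ) : ℤ)) = (n : ℤ) + 1 := by push_cast; ring
    simp only [hflux, ha, hE, h3]
    ring
  have hB : a N * flux N = ((q + 1 : ℕ) : ℝ) * (c N * ((1 / 2 : ℝ) * Z N t ^ 2) ^ q) *
      (c₀ * b ^ ((5 : ℝ) * (N : ℝ) / 2) * Z N t ^ 2 * Z ((N : ℤ) + 1) t) := by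
    simp only [ha, hflux, hE]
  have hC : ∑ n ∈ range (N + 1),
      ((q + 1 : ℕ) : ℝ) * (2 * (ν * b ^ ((2 : ℝ) * (n : ℝ))) * (c n * E n ^ (q + 1))) =
      ((q + 1 : ℕ) : ℝ) * ∑ n ∈ range (N + 1),
        2 * (ν * b ^ ((2 : ℝ) * (n : ℝ))) * (c n * ((1 / 2 : ℝ) * Z n t ^ 2) ^ (q + 1)) := by
    rw [Finset.mul_sum]
  rw [hA, hB, hC]

/-! ## The Kolmogorov form of the production -/

/-- **The entropy production is shell-free in the Kolmogorov currency.**  For the entropy weights `β^n`,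
`β = (b^{5/3})^{p-1}`, and any two shell energies `E` (shell `n`) and `E'` (shell `n+1`):
`β^{n+1} E'^{p-1} − β^n E^{p-1} = ((b^{5/3})^{n+1} E')^{p-1} − ((b^{5/3})^n E)^{p-1}` — the production density of
`entropyPartialSum_hasDerivWithinAt` at the bond `n` is `Π_n (w_{n+1}^{p-1} − w_n^{p-1})` with the Kolmogorov-weighted
energies `w_m = (b^{5/3})^m E_m`; it vanishes on K41 plateaus and is negative exactly at steep bonds `w_{n+1} < w_n`.
[this file] -/
theorem entropyWeight_production_kolmogorovForm (b : ℝ) (p n : ℕ) (E E' : ℝ) :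
    ((b ^ ((5 : ℝ) / 3)) ^ (p - 1)) ^ (n + 1) * E' ^ (p - 1) - ((b ^ ((5 : ℝ) / 3)) ^ (p - 1)) ^ n * E ^ (p - 1) =
      ((b ^ ((5 : ℝ) / 3)) ^ (n + 1) * E') ^ (p - 1) - ((b ^ ((5 : ℝ) / 3)) ^ n * E) ^ (p - 1) := by
  rw [mul_pow, mul_pow, ← pow_mul, ← pow_mul, ← pow_mul, ← pow_mul, mul_comm (p - 1) (n + 1), mul_comm (p - 1) n]

/-- The entropy weights are the `p = 1 + (p-1)` bookkeeping of the registered exponent: `(b^{5/3})^{p-1} = b^{(5/3)(p-1)}`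
(`b > 0`, `p ≥ 1`). [this file] -/
theorem entropyWeight_eq_rpow {b : ℝ} (hb : 0 < b) {p : ℕ} (hp : 1 ≤ p) :
    (b ^ ((5 : ℝ) / 3)) ^ (p - 1) = b ^ ((5 : ℝ) / 3 * ((p : ℝ) - 1)) := by
  rw [← Real.rpow_natCast, ← Real.rpow_mul hb.le]
  congr 1
  rw [Nat.cast_sub hp]
  push_cast
  ring

/-! ## Sign corollary and the datum value -/

/-- **No inverted bond ⇒ the partial entropy decays.**  Non-negative chain (`c₀ ≥ 0`, `ν ≥ 0`, `b > 0`, shells `≥ 1`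
non-negative on `[0,s]`), weights `c_n ≥ 0`: if at every time of the window and every bond `n < N` the weighted
profile is non-increasing across the bond, `c_{n+1} E_{n+1}^{p-1} ≤ c_n E_n^{p-1}`, then `Σ_{n≤N} c_n E_n^p` is
non-increasing on `[0,s]` (production `≤ 0`, outflow `≥ 0`, dissipation `≥ 0`). [this file] -/
theorem entropyPartialSum_antitoneOn {b c₀ ν s : ℝ} (hb : 0 < b) (hc₀ : 0 ≤ c₀) (hν : 0 ≤ ν) {Z : ℤ → ℝ → ℝ}
    (hvan : ∀ t, Z (-1) t = 0)
    (hode : ∀ k : ℕ, ∀ t ∈ Icc 0 s, HasDerivWithinAt (Z k)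
      (c₀ * (b ^ ((5 : ℝ) * ((k : ℝ) - 1) / 2) * Z ((k : ℤ) - 1) t ^ 2 -
          b ^ ((5 : ℝ) * (k : ℝ) / 2) * (Z k t * Z ((k : ℤ) + 1) t)) -
        ν * b ^ ((2 : ℝ) * (k : ℝ)) * Z k t) (Icc 0 s) t)
    (hnn : ∀ t ∈ Icc 0 s, ∀ k : ℕ, 1 ≤ k → 0 ≤ Z k t)
    {c : ℕ → ℝ} (hc : ∀ n, 0 ≤ c n) {p : ℕ} (hp : 1 ≤ p) (N : ℕ)
    (hsteep : ∀ t ∈ Icc 0 s, ∀ n < N,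
      c (n + 1) * ((1 / 2 : ℝ) * Z ((n : ℤ) + 1) t ^ 2) ^ (p - 1) ≤ c n * ((1 / 2 : ℝ) * Z n t ^ 2) ^ (p - 1)) :
    AntitoneOn (fun τ => ∑ n ∈ range (N + 1), c n * ((1 / 2 : ℝ) * Z n τ ^ 2) ^ p) (Icc 0 s) := by
  have hderiv := fun t (ht : t ∈ Icc 0 s) => entropyPartialSum_hasDerivWithinAt hvan hode c hp N ht
  refine antitoneOn_of_deriv_nonpos (convex_Icc 0 s)
    (fun t ht => (hderiv t ht).continuousWithinAt) (fun t ht => ?_) (fun t ht => ?_)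
  · rw [interior_Icc] at ht
    exact ((hderiv t (Ioo_subset_Icc_self ht)).hasDerivAt
      (Icc_mem_nhds ht.1 ht.2)).differentiableAt.differentiableWithinAt
  · rw [interior_Icc] at ht
    have ht' : t ∈ Icc 0 s := Ioo_subset_Icc_self ht
    rw [((hderiv t ht').hasDerivAt (Icc_mem_nhds ht.1 ht.2)).deriv]
    -- fluxes are non-negative
    have hflux : ∀ n : ℕ, 0 ≤ c₀ * b ^ ((5 : ℝ) * (n : ℝ) / 2) * Z n t ^ 2 * Z ((n : ℤ) + 1) t := by
      intro n
      have hz : 0 ≤ Z ((n : ℤ) + 1) t := by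
        have := hnn t ht' (n + 1) (by omega)
        push_cast at this
        exact this
      exact mul_nonneg (mul_nonneg (mul_nonneg hc₀ (Real.rpow_pos_of_pos hb _).le) (sq_nonneg _)) hz
    have hp0 : (0 : ℝ) ≤ (p : ℝ) := Nat.cast_nonneg p
    have h1 : (p : ℝ) * ∑ n ∈ range N,
        (c₀ * b ^ ((5 : ℝ) * (n : ℝ) / 2) * Z n t ^ 2 * Z ((n : ℤ) + 1) t) *
          (c (n + 1) * ((1 / 2 : ℝ) * Z ((n : ℤ) + 1) t ^ 2) ^ (p - 1) -
            c n * ((1 / 2 : ℝ) * Z n t ^ 2) ^ (p - 1)) ≤ 0 := by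
      refine mul_nonpos_of_nonneg_of_nonpos hp0 (Finset.sum_nonpos fun n hn => ?_)
      exact mul_nonpos_of_nonneg_of_nonpos (hflux n) (sub_nonpos.2 (hsteep t ht' n (mem_range.1 hn)))
    have h2 : 0 ≤ (p : ℝ) * (c N * ((1 / 2 : ℝ) * Z N t ^ 2) ^ (p - 1)) *
        (c₀ * b ^ ((5 : ℝ) * (N : ℝ) / 2) * Z N t ^ 2 * Z ((N : ℤ) + 1) t) :=
      mul_nonneg (mul_nonneg hp0 (mul_nonneg (hc N) (pow_nonneg (by positivity) _))) (hflux N)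
    have h3 : 0 ≤ (p : ℝ) * ∑ n ∈ range (N + 1),
        2 * (ν * b ^ ((2 : ℝ) * (n : ℝ))) * (c n * ((1 / 2 : ℝ) * Z n t ^ 2) ^ p) := by
      refine mul_nonneg hp0 (Finset.sum_nonneg fun n _ => ?_)
      exact mul_nonneg (mul_nonneg (by norm_num) (mul_nonneg hν (Real.rpow_pos_of_pos hb _).le))
        (mul_nonneg (hc n) (pow_nonneg (by positivity) _))
    linarith

/-- **Datum value.**  From the one-shell datum `Z_k(0) = x₀ 1_{k=0}` the partial entropy at time `0` is its shell-`0`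
term: `Σ_{n≤N} c_n E_n(0)^p = c_0 (½x₀²)^p` (`p ≥ 1`). [this file] -/
theorem entropyPartialSum_datum {x₀ : ℝ} {Z : ℤ → ℝ → ℝ} (hdat : ∀ k : ℤ, Z k 0 = if k = 0 then x₀ else 0)
    (c : ℕ → ℝ) {p : ℕ} (hp : 1 ≤ p) (N : ℕ) :
    ∑ n ∈ range (N + 1), c n * ((1 / 2 : ℝ) * Z n 0 ^ 2) ^ p = c 0 * ((1 / 2 : ℝ) * x₀ ^ 2) ^ p := by
  obtain ⟨q, rfl⟩ : ∃ q, p = q + 1 := ⟨p - 1, by omega⟩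
  rw [Finset.sum_eq_single_of_mem 0 (by simp)]
  · simp [hdat]
  · intro n _ hn
    have h : Z (n : ℤ) 0 = 0 := by
      rw [hdat]; simp [hn]
    simp [h]

/-- **The barrier-violation budget (sum currency).**  Non-negative chain from a one-shell datum, entropy weights
`c_n = ((b^{5/3})^{p-1})^n`: if at some time `t ∈ [0,s]` and shell `m ≤ N` the `θ_p`-barrier with constant `1` fails in
the form `((b^{5/3})^{p-1})^m E_m(t)^p > (½x₀²)^p` (one entropy term above the datum entropy), then the partial entropy has
GROWN: `Σ_{n≤N} c_n E_n(t)^p > Σ_{n≤N} c_n E_n(0)^p` — so by `entropyPartialSum_antitoneOn` some bond `n < N` was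
inverted (`c_{n+1}E_{n+1}^{p-1} > c_n E_n^{p-1}`) at some time in `[0,t]`. [this file] -/
theorem exists_invertedBond_of_entropyTerm_gt {b c₀ ν s x₀ : ℝ} (hb : 0 < b) (hc₀ : 0 ≤ c₀) (hν : 0 ≤ ν)
    {Z : ℤ → ℝ → ℝ} (hdat : ∀ k : ℤ, Z k 0 = if k = 0 then x₀ else 0)
    (hvan : ∀ t, Z (-1) t = 0)
    (hode : ∀ k : ℕ, ∀ t ∈ Icc 0 s, HasDerivWithinAt (Z k)
      (c₀ * (b ^ ((5 : ℝ) * ((k : ℝ) - 1) / 2) * Z ((k : ℤ) - 1) t ^ 2 -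
          b ^ ((5 : ℝ) * (k : ℝ) / 2) * (Z k t * Z ((k : ℤ) + 1) t)) -
        ν * b ^ ((2 : ℝ) * (k : ℝ)) * Z k t) (Icc 0 s) t)
    (hnn : ∀ t ∈ Icc 0 s, ∀ k : ℕ, 1 ≤ k → 0 ≤ Z k t)
    {p : ℕ} (hp : 1 ≤ p) {N m : ℕ} (hm : m ≤ N) {t : ℝ} (ht : t ∈ Icc 0 s)
    (hviol : ((1 / 2 : ℝ) * x₀ ^ 2) ^ p <
      ((b ^ ((5 : ℝ) / 3)) ^ (p - 1)) ^ m * ((1 / 2 : ℝ) * Z m t ^ 2) ^ p) :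
    ∃ τ ∈ Icc 0 s, τ ≤ t ∧ ∃ n < N,
      ((b ^ ((5 : ℝ) / 3)) ^ (p - 1)) ^ n * ((1 / 2 : ℝ) * Z n τ ^ 2) ^ (p - 1) <
        ((b ^ ((5 : ℝ) / 3)) ^ (p - 1)) ^ (n + 1) * ((1 / 2 : ℝ) * Z ((n : ℤ) + 1) τ ^ 2) ^ (p - 1) := by
  set c : ℕ → ℝ := fun n => ((b ^ ((5 : ℝ) / 3)) ^ (p - 1)) ^ n with hcdef
  have hc : ∀ n, 0 ≤ c n := fun n => pow_nonneg (pow_nonneg (Real.rpow_pos_of_pos hb _).le _) _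
  by_contra hcon
  simp only [not_exists, not_and, not_lt] at hcon
  -- no inverted bond on `[0,t]` ⇒ the partial entropy is non-increasing on `[0,t]`
  have hts : t ≤ s := ht.2
  have hode' : ∀ k : ℕ, ∀ τ ∈ Icc 0 t, HasDerivWithinAt (Z k)
      (c₀ * (b ^ ((5 : ℝ) * ((k : ℝ) - 1) / 2) * Z ((k : ℤ) - 1) τ ^ 2 -
          b ^ ((5 : ℝ) * (k : ℝ) / 2) * (Z k τ * Z ((k : ℤ) + 1) τ)) -
        ν * b ^ ((2 : ℝ) * (k : ℝ)) * Z k τ) (Icc 0 t) τ :=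
    fun k τ hτ => (hode k τ ⟨hτ.1, hτ.2.trans hts⟩).mono (Icc_subset_Icc le_rfl hts)
  have hnn' : ∀ τ ∈ Icc 0 t, ∀ k : ℕ, 1 ≤ k → 0 ≤ Z k τ :=
    fun τ hτ k hk => hnn τ ⟨hτ.1, hτ.2.trans hts⟩ k hk
  have hsteep : ∀ τ ∈ Icc 0 t, ∀ n < N,
      c (n + 1) * ((1 / 2 : ℝ) * Z ((n : ℤ) + 1) τ ^ 2) ^ (p - 1) ≤ c n * ((1 / 2 : ℝ) * Z n τ ^ 2) ^ (p - 1) :=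
    fun τ hτ n hn => hcon τ ⟨hτ.1, hτ.2.trans hts⟩ hτ.2 n hn
  have hanti := entropyPartialSum_antitoneOn hb hc₀ hν hvan hode' hnn' hc hp N hsteep
  have hle : ∑ n ∈ range (N + 1), c n * ((1 / 2 : ℝ) * Z n t ^ 2) ^ p ≤
      ∑ n ∈ range (N + 1), c n * ((1 / 2 : ℝ) * Z n 0 ^ 2) ^ p :=
    hanti (left_mem_Icc.2 ht.1) (right_mem_Icc.2 ht.1) ht.1
  -- compare with the datum value and the violated term
  have h0 : ∑ n ∈ range (N + 1), c n * ((1 / 2 : ℝ) * Z n 0 ^ 2) ^ p = c 0 * ((1 / 2 : ℝ) * x₀ ^ 2) ^ p :=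
    entropyPartialSum_datum hdat c hp N
  have hc0 : c 0 = 1 := by simp [hcdef]
  have hterm : c m * ((1 / 2 : ℝ) * Z m t ^ 2) ^ p ≤ ∑ n ∈ range (N + 1), c n * ((1 / 2 : ℝ) * Z n t ^ 2) ^ p :=
    Finset.single_le_sum (f := fun n => c n * ((1 / 2 : ℝ) * Z n t ^ 2) ^ p)
      (fun n _ => mul_nonneg (hc n) (pow_nonneg (by positivity) _)) (mem_range.2 (by omega))
  have : c m * ((1 / 2 : ℝ) * Z m t ^ 2) ^ p ≤ ((1 / 2 : ℝ) * x₀ ^ 2) ^ p := by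
    have := hterm.trans hle
    rw [h0, hc0, one_mul] at this
    exact this
  exact absurd hviol (not_lt.2 this)

end Summit.NavierStokesRegularity.NavierStokesRegularity.Theorems.KPChainEntropy

end
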